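import Summits.ResolutionOfSingularities.ResolutionOfSingularities.Theorems.WildPurityWildSymbolDivIntegralLocAt
import Summits.ResolutionOfSingularities.ResolutionOfSingularities.Theorems.ValuativeLuAlphaPTorsorBirationalExit
import HarnessLib

/-!
# `WildSymbol` (stmt-ResolutionOfSingularities-17133), line `birth` — the test class of (D) is blind to
# Frobenius: radical (in particular `p`-radical) enlargements of the affine model are free

Support file for crux #2 of route `ResolutionOfSingularities/WildPurity`
(`Summit.ResolutionOfSingularities.ResolutionOfSingularities.Theses.WildPurity.WildSymbol`), line `birth`
(definitions `Theorems/WildPurityWildSymbolBirthDefs.lean`; (D) = `DivIntegral`, the local ring of the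
point `locAt R O`, `divIntegral_iff_locAt` in `Theorems/WildPurityWildSymbolDivIntegralLocAt.lean`).

Condition (D) of the crux tests the divisorial valuation rings `W` (DVR, `k ⊆ W`, essentially of finite
type over `k`) with `R ⊆ W` and centre on `R` inside the centre of `O`; by `divIntegral_iff_locAt` this is
the class of divisorial `W ⊇ S`, `S := locAt R O`. A valuation ring is closed under extracting roots
(`PfaffLine.mem_valuationSubring_of_pow_mem`, landed: `xᵐ ∈ W`, `m ≠ 0` ⇒ `x ∈ W`) and so is its
maximal ideal
(`mem_nonunits_of_pow_mem_nonunits`). Consequently (D) does not change when the model `R` is ENLARGED by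
finitely many elements of `O` each of which has a power in `S` — more precisely by any `R' ⊇ R` every
element of which has a power in `S` (`divIntegral_iff_of_radical`); in characteristic `p` this covers
every `R' = R[y₁, …, yₙ]` with `yᵢ^{p^e} ∈ S`, since Frobenius is additive (`divIntegral_iff_of_pRadical`,
the `p`-radical hypothesis being checked on GENERATORS of `R'` over `R`).

Why this matters for the crux (lead's notes, `Cruxes/WildSymbol/NOTES.md` §Sandwich reduction): Temkin's
inseparable local uniformization (arXiv:0804.1554, Thm. 1.2 with Remark 1.5 (i)) produces, for every
`(K, O, R)`, a REGULAR local ring `A₀ ⊆ O`, essentially of finite type over `k`, with `R^{pⁿ} ⊆ A₀` and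
`K` finite purely inseparable over `Frac A₀`; the present lemma is the formal reason why the whole test
class of (D) survives the passage from `R` to the normalisation of `A₀` in `K` (a "Frobenius sandwich"),
on which the crux therefore concentrates. No witness can exploit a non-`p`-radically-closed model.

Contents:
* `mem_locAt_iff` — normal form: `x ∈ locAt R O ↔ x·s = r` for some `r, s ∈ R`, `s ∉ 𝔪_O`.
* `mem_nonunits_of_pow_mem_nonunits`, `pow_mem_nonunits` — root-closedness of `𝔪_W`.
* `centre_locAt` — the centre condition propagates from `R` to `locAt R O`.
* `divIntegral_iff_of_radical` — **(D) is invariant under radical enlargement of the model.**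
* `divIntegral_iff_of_pRadical` — the same with the hypothesis on generators, exponents `p^e`.

No definition is declared; nothing here concludes the crux.
-/

noncomputable section

-- single-problem summit: the doubled namespace component `ResolutionOfSingularities` is forced
set_option linter.dupNamespace false

namespace Summit.ResolutionOfSingularities.ResolutionOfSingularities.Theorems.WildSymbol.Birth

variable {k K : Type} [Field k] [Field K] [Algebra k K]

/-! ## Normal form of the elements of `locAt R O` -/

/-- **Normal form.** For a subalgebra `R` (closed under `+`, `·`), the local ring `locAt R O` (defined as
the subring generated by the fractions `r/s`, `r, s ∈ R`, `s ∉ 𝔪_O`) consists exactly of such fractions: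
`x ∈ locAt R O ↔ ∃ r s ∈ R, s ∉ 𝔪_O, x·s = r`. (The set of such `x` is already a subring: denominators
outside `𝔪_O` are closed under products because `O.valuation (s·t) = O.valuation s · O.valuation t ≥ 1`.)
[folklore] -/
theorem mem_locAt_iff (R : Subalgebra k K) (O : ValuationSubring K) (x : K) :
    x ∈ locAt (R : Set K) O ↔ ∃ r s : K, r ∈ R ∧ s ∈ R ∧ s ∉ O.nonunits ∧ x * s = r := by
  -- denominators: elements of valuation `≥ 1` are closed under multiplication
  have hden : ∀ s t : K, s ∉ O.nonunits → t ∉ O.nonunits → s * t ∉ O.nonunits := by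
    intro s t hs ht hst
    rw [ValuationSubring.mem_nonunits_iff, not_lt] at hs ht
    rw [ValuationSubring.mem_nonunits_iff, map_mul] at hst
    have h11 : (1 : _) * 1 ≤ O.valuation s * O.valuation t := mul_le_mul' hs ht
    rw [one_mul] at h11
    exact not_lt.mpr h11 hst
  have h1 : (1 : K) ∉ O.nonunits := by
    rw [ValuationSubring.mem_nonunits_iff, map_one]; exact lt_irrefl 1
  -- the candidate carrier is a subring
  let S : Subring K :=
    { carrier := {x | ∃ r s : K, r ∈ R ∧ s ∈ R ∧ s ∉ O.nonunits ∧ x * s = r}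
      mul_mem' := by
        rintro x y ⟨r, s, hr, hs, hsu, hx⟩ ⟨r', s', hr', hs', hsu', hy⟩
        refine ⟨r * r', s * s', R.mul_mem hr hr', R.mul_mem hs hs', hden s s' hsu hsu', ?_⟩
        calc x * y * (s * s') = (x * s) * (y * s') := by ring
          _ = r * r' := by rw [hx, hy]
      one_mem' := ⟨1, 1, R.one_mem, R.one_mem, h1, by ring⟩
      add_mem' := by
        rintro x y ⟨r, s, hr, hs, hsu, hx⟩ ⟨r', s', hr', hs', hsu', hy⟩
        refine ⟨r * s' + r' * s, s * s', R.add_mem (R.mul_mem hr hs') (R.mul_mem hr' hs),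
          R.mul_mem hs hs', hden s s' hsu hsu', ?_⟩
        calc (x + y) * (s * s') = (x * s) * s' + (y * s') * s := by ring
          _ = r * s' + r' * s := by rw [hx, hy]
      zero_mem' := ⟨0, 1, R.zero_mem, R.one_mem, h1, by ring⟩
      neg_mem' := by
        rintro x ⟨r, s, hr, hs, hsu, hx⟩
        exact ⟨-r, s, R.neg_mem hr, hs, hsu, by rw [neg_mul, hx]⟩ }
  constructor
  · intro hx
    have hle : locAt (R : Set K) O ≤ S := Subring.closure_le.mpr fun y hy => hy
    exact hle hx
  · intro hx
    exact Subring.subset_closure hx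

/-! ## Root-closedness of a valuation ring and of its maximal ideal -/

-- Root-closedness of `W` itself (`xᵐ ∈ W`, `m ≠ 0` ⇒ `x ∈ W`) is the landed
-- `Theorems.PfaffLine.mem_valuationSubring_of_pow_mem` (imported), reused below.

/-- The maximal ideal of a valuation ring is root-closed: `xᵐ ∈ 𝔪_W`, `m ≠ 0` ⇒ `x ∈ 𝔪_W`. [folklore] -/
theorem mem_nonunits_of_pow_mem_nonunits (W : ValuationSubring K) {x : K} {m : ℕ} (hm : m ≠ 0)
    (hx : x ^ m ∈ W.nonunits) : x ∈ W.nonunits := by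
  have _ := hm
  rw [ValuationSubring.mem_nonunits_iff] at hx ⊢
  rw [map_pow] at hx
  by_contra h
  exact not_le.mpr hx (one_le_pow₀ (not_lt.mp h))

/-- Powers of non-units are non-units: `x ∈ 𝔪_W`, `m ≠ 0` ⇒ `xᵐ ∈ 𝔪_W`. [folklore] -/
theorem pow_mem_nonunits (W : ValuationSubring K) {x : K} {m : ℕ} (hm : m ≠ 0)
    (hx : x ∈ W.nonunits) : x ^ m ∈ W.nonunits := by
  rw [ValuationSubring.mem_nonunits_iff] at hx ⊢
  rw [map_pow]
  exact pow_lt_one₀ zero_le hx hm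

/-! ## The centre condition propagates to the local ring of the point -/

/-- If `R ⊆ W` and the centre of `W` on `R` lies inside the centre of `O`, then the same holds
for the local ring of the point: `𝔪_W ∩ locAt R O ⊆ 𝔪_O`. (Write `x = r/s`; `s ∉ 𝔪_O` forces `s ∉ 𝔪_W`,
so `r = x·s ∈ 𝔪_W ∩ R ⊆ 𝔪_O` and `x = r·s⁻¹ ∈ 𝔪_O`.) [folklore] -/
theorem centre_locAt (R : Subalgebra k K) (O W : ValuationSubring K)
    (hRW : R.toSubring ≤ W.toSubring)
    (hcen : ∀ x : K, x ∈ R → x ∈ W.nonunits → x ∈ O.nonunits) :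
    ∀ x : K, x ∈ locAt (R : Set K) O → x ∈ W.nonunits → x ∈ O.nonunits := by
  intro x hx hxW
  obtain ⟨r, s, hr, hs, hsO, hxs⟩ := (mem_locAt_iff R O x).mp hx
  have hs0 : s ≠ 0 := ne_zero_of_not_mem_nonunits O hsO
  have hrW : r ∈ W.nonunits := by
    rw [← hxs]
    exact mul_mem_nonunits W hxW (hRW hs)
  have hrO : r ∈ O.nonunits := hcen r hr hrW
  have hx' : x = r * s⁻¹ := by rw [← hxs, mul_assoc, mul_inv_cancel₀ hs0, mul_one]
  rw [hx']
  exact mul_mem_nonunits O hrO (inv_mem_of_not_mem_nonunits O hsO)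

/-! ## (D) is invariant under radical enlargement of the model -/

/-- **The test class of (D) is blind to radical enlargements of the model.** Let `R ⊆ R'` be
`k`-subalgebras of `K`, and suppose every element of `R'` has a positive power in the local
ring `locAt R O` of the point (e.g. `R' = R[y₁, …, yₙ]` with `yᵢ^{p^e} ∈ locAt R O` in characteristic
`p`). Then condition (D) for the model `R` and for the model `R'` are EQUIVALENT: a divisorial `W`
admissible for `R` (i.e. `W ⊇ locAt R O`) contains `R'` because `W` is root-closed, and its centre on `R'`
lies inside the centre of `O` because `𝔪_W` and `𝔪_O` are root-closed and the centre condition holds on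
`locAt R O` (`centre_locAt`); the converse direction only uses `R ⊆ R'`. [folklore] -/
theorem divIntegral_iff_of_radical (p : ℕ) (R R' : Subalgebra k K) (O : ValuationSubring K)
    (α : G K ⧸ N p K) (hRR' : R ≤ R')
    (hrad : ∀ y : K, y ∈ R' → ∃ m : ℕ, m ≠ 0 ∧ y ^ m ∈ locAt (R : Set K) O) :
    DivIntegral p k K R O α ↔ DivIntegral p k K R' O α := by
  constructor
  · intro h W hk hdvr heft hR'W hcen'
    exact h W hk hdvr heft (fun x hx => hR'W (hRR' hx)) (fun x hx hxW => hcen' x (hRR' hx) hxW)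
  · intro h W hk hdvr heft hRW hcen
    have hSW : locAt (R : Set K) O ≤ W.toSubring := locAt_le_of_centre R O W hRW hcen
    have hcenS := centre_locAt R O W hRW hcen
    refine h W hk hdvr heft ?_ ?_
    · intro y hy
      obtain ⟨m, hm, hym⟩ := hrad y hy
      exact PfaffLine.mem_valuationSubring_of_pow_mem W hm (hSW hym)
    · intro y hy hyW
      obtain ⟨m, hm, hym⟩ := hrad y hy
      exact mem_nonunits_of_pow_mem_nonunits O hm (hcenS _ hym (pow_mem_nonunits W hm hyW))

/-- **The `p`-radical case, hypothesis on generators.** In characteristic `p`, if `R' ⊆ K` is generated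
over `R` by a set `T` of elements with `y^{p^e} ∈ locAt R O` (one `e` for all `y ∈ T` — harmless, take
the maximum over a finite generating set), then every element of `R'` has its `p^e`-th power in
`locAt R O` (Frobenius is a ring homomorphism and `R ⊆ locAt R O`), so (D) for `R` and for `R'`
coincide. This is the shape in which Temkin's inseparable local uniformization enlarges the model
(`R ↦` the normalisation in `K` of a regular `A₀ ⊇ R^{p^e}`). [folklore] -/
theorem divIntegral_iff_of_pRadical (p : ℕ) [hp : Fact p.Prime] [CharP K p] (R : Subalgebra k K)
    (O : ValuationSubring K) (α : G K ⧸ N p K) (T : Set K) (e : ℕ)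
    (hT : ∀ y ∈ T, y ^ (p ^ e) ∈ locAt (R : Set K) O) :
    DivIntegral p k K R O α ↔ DivIntegral p k K (R ⊔ Algebra.adjoin k T) O α := by
  refine divIntegral_iff_of_radical p R (R ⊔ Algebra.adjoin k T) O α le_sup_left ?_
  intro y hy
  refine ⟨p ^ e, pow_ne_zero e hp.out.ne_zero, ?_⟩
  -- `y ↦ y^{p^e}` is the iterated Frobenius, a ring homomorphism `K →+* K`; the elements of `R ⊔ adjoin T`
  -- whose `p^e`-th power lies in `locAt R O` form a subalgebra containing `R` and `T`.
  let φ : K →+* K := iterateFrobenius K p e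
  have hφ : ∀ z : K, φ z = z ^ (p ^ e) := fun z => iterateFrobenius_def ..
  let B : Subalgebra k K :=
    { ((locAt (R : Set K) O).comap φ) with
      algebraMap_mem' := fun c => by
        show φ (algebraMap k K c) ∈ locAt (R : Set K) O
        rw [hφ]
        exact le_locAt R O (R.pow_mem (R.algebraMap_mem c) _) }
  have hB : ∀ z : K, z ∈ B ↔ z ^ (p ^ e) ∈ locAt (R : Set K) O := fun z => by
    show φ z ∈ locAt (R : Set K) O ↔ _
    rw [hφ]
  have hle : R ⊔ Algebra.adjoin k T ≤ B := by
    refine sup_le ?_ (Algebra.adjoin_le ?_)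
    · intro z hz
      exact (hB z).mpr (le_locAt R O (R.pow_mem hz _))
    · intro z hz
      exact (hB z).mpr (hT z hz)
  exact (hB y).mp (hle hy)

end Summit.ResolutionOfSingularities.ResolutionOfSingularities.Theorems.WildSymbol.Birth

end
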